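import Summits.QuantumFields.YangMills.Theorems.LocalInsertionSublevelDoublingPlaquette
import Summits.QuantumFields.YangMills.Theorems.LangevinControlUVFemtoCurvatureTwoPointCStubSliceLoc
import HarnessLib

/-!
# Sublevel doubling of Wilson's action on `(ℤ/L)^d`, every `d` — local injectivity of the slice parametrisation (LOC)

Crux `HistoryTailL` (stmt-QuantumFields-19936), level-0 lane (T4) «uniform doubling», row (T4-SUB), file 6: the `{d : ℕ}`-generic port
(literal `4 ↦ d`, proofs verbatim) of `Theorems/LangevinControlUVFemtoCurvatureTwoPointCStubSliceLoc.lean` (route `LangevinControlUV`,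
crux `FemtoCurvatureTwoPointC`, line `Sketch`, `stub_sliceLoc`); the abstract, d-FREE co-Lipschitz lemma
`SliceLoc.coLipschitz_of_hasStrictFDerivAt` is IMPORTED from that file, not copied.

Near a configuration `τ` of the lattice gauge field on `(ℤ/L)^d` every configuration is written as `E η · cfg τ A` — the gauge
transformation generated by a `𝔤`-valued site function `η` orthogonal to the zero modes `W₀ = zeroModes τ`, applied to the exponential
chart point `cfg τ A (x,i) = E(A(x,i)) τ(x,i)` over a 1-form `A` in the gauge slice `𝒴 = slice τ = (range d⁰)ᗮ` (vocabulary of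
`…SublevelDoublingDefs`). `sliceLoc`: there are `δ, K > 0` such that for `η, η' ∈ W₀ᗮ`, `A, A' ∈ 𝒴` of norm `< δ` and `0 < s ≤ 1`,
`s ‖F(η, A) − F(η', A')‖ ≤ K ‖F(η, sA) − F(η', sA')‖`, `F(η, A) = (ρ((E η · cfg τ A) e))_e` — the scaling map
`E η · cfg τ A ↦ E η · cfg τ (sA)` is well defined and co-Lipschitz by `K/s`. Proof: componentwise
`F(η, A) e = e^{M η(x)} e^{M A(e)} ρ(τ e) e^{−M η(x+e_i)}`, so `F` has at `0` a STRICT derivative `L` with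
`L(η̇, Ȧ) e = M((d⁰η̇) e + Ȧ e) ρ(τ e)`, injective on `W₀ᗮ × 𝒴`, hence bounded below (finite dimension); strictness gives the two-sided
comparison. Flatness of `τ` is not used. Rung R3 (continuum SU(2) YM₃ on T³) — not infinite volume, not a mass gap, not Clay.
Mathlib + the tree's exponential chart files; no named facts; no definitions.
-/

set_option autoImplicit false

noncomputable section

open scoped Matrix Matrix.Norms.Frobenius InnerProductSpace Topology
open NormedSpace Filter
open Literature.MathematicalPhysics.QuantumLattice Literature.MathematicalPhysics.QuantumFieldTheory
open Summit.QuantumFields.YangMills.Theorems.FreeEnergyLogCoefficient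
open Summit.QuantumFields.YangMills.Theorems.FemtoCurvatureTwoPointC.Doubling (Fib adFib lieIso_adFib adFib_mul adFib_one
  adFib_inv_apply adFib_apply_inv inner_adFib rho_inv_mul rho_mul_inv rho_matrix_inv isUnit_rho conjTranspose_rho
  rho_inv_conj_conj exp_lieIso_adFib exp_neg_lieIso_adFib expChart_adFib rho_expChart_inv sub_re_trace_eq_norm_sq
  re_trace_conjTranspose_conj_mul)

namespace Summit.QuantumFields.YangMills.Theorems.LocalInsertion.SublevelDoubling

namespace SliceLoc

/-! ## The parametrisation in matrices and its strict derivative at `0` -/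

variable {G : Type} [Group G] [TopologicalSpace G] [CompactSpace G] (r : LatticeRep G) {d L : ℕ}

/-- The parametrisation in matrices, componentwise:
`ρ((E η · cfg τ A)(x,i)) = e^{M η(x)} e^{M A(x,i)} ρ(τ(x,i)) e^{-M η(x+e_i)}`. -/
theorem rho_gaugeTransform_gaugeExp_cfg (τ : GaugeConfig d L G) (η : SiteFun r d L) (A : OneForm r d L)
    (e : Edge d L) :
    r.ρ (gaugeTransform (gaugeExp r η) (cfg r τ A) e) =
      exp (lieIso r.ρ (η e.1)) * exp (lieIso r.ρ (A e)) * r.ρ (τ e) *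
        exp (-lieIso r.ρ (η (e.1.shift e.2))) := by
  rw [rho_gaugeTransform_cfg]
  simp only [gaugeExp]
  rw [rho_expChart r.ρ r.continuous, rho_expChart_inv]

/-- The derivative formula: `M(η̇ x) T − T M(η̇(x+e_i)) + M(Ȧ e) T = M((d⁰η̇) e + Ȧ e) T`, `T = ρ(τ e)`
(`T M(b) T⁻¹ = M(Ad_{τ e} b)`). -/
theorem lieIso_dZero_add_mul (τ : GaugeConfig d L G) (v : SiteFun r d L × OneForm r d L) (e : Edge d L) :
    lieIso r.ρ (dZero r τ v.1 e + v.2 e) * r.ρ (τ e) =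
      lieIso r.ρ (v.1 e.1) * r.ρ (τ e) - r.ρ (τ e) * lieIso r.ρ (v.1 (e.1.shift e.2)) +
        lieIso r.ρ (v.2 e) * r.ρ (τ e) := by
  rw [show dZero r τ v.1 e = v.1 e.1 - adFib r (τ e) (v.1 (e.1.shift e.2)) from rfl, map_add, map_sub,
    lieIso_adFib, Matrix.add_mul, Matrix.sub_mul, Matrix.mul_assoc _ (r.ρ (τ e)⁻¹) (r.ρ (τ e)), rho_inv_mul,
    Matrix.mul_one]

variable [NeZero L]

/-- **Strict derivative of one component of the parametrisation at `0`**: the map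
`(η, A) ↦ ρ((E η · cfg τ A) e)` has at `(0, 0)` a strict derivative `φ'` with
`φ' (η̇, Ȧ) = M((d⁰η̇) e + Ȧ e) · ρ(τ e)`. -/
theorem exists_hasStrictFDerivAt_comp (τ : GaugeConfig d L G) (e : Edge d L) :
    ∃ φ' : (SiteFun r d L × OneForm r d L) →L[ℝ] Matrix (Fin r.N) (Fin r.N) ℂ,
      HasStrictFDerivAt (fun p : SiteFun r d L × OneForm r d L =>
        r.ρ (gaugeTransform (gaugeExp r p.1) (cfg r τ p.2) e)) φ' 0 ∧
      ∀ v : SiteFun r d L × OneForm r d L,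
        φ' v = lieIso r.ρ (dZero r τ v.1 e + v.2 e) * r.ρ (τ e) := by
  -- the three linear maps `p ↦ M (p.1 e.1)`, `p ↦ M (p.2 e)`, `p ↦ -M (p.1 (e.1 + e_i))`
  set Mc : Fib r →L[ℝ] Matrix (Fin r.N) (Fin r.N) ℂ := (lieIso r.ρ).toContinuousLinearMap
  set ℓ₁ : (SiteFun r d L × OneForm r d L) →L[ℝ] Matrix (Fin r.N) (Fin r.N) ℂ :=
    (Mc.comp (PiLp.proj 2 (fun _ : Site d L => Fib r) e.1)).comp
      (ContinuousLinearMap.fst ℝ (SiteFun r d L) (OneForm r d L))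
  set ℓ₂ : (SiteFun r d L × OneForm r d L) →L[ℝ] Matrix (Fin r.N) (Fin r.N) ℂ :=
    (Mc.comp (PiLp.proj 2 (fun _ : Edge d L => Fib r) e)).comp
      (ContinuousLinearMap.snd ℝ (SiteFun r d L) (OneForm r d L))
  set ℓ₃ : (SiteFun r d L × OneForm r d L) →L[ℝ] Matrix (Fin r.N) (Fin r.N) ℂ :=
    -((Mc.comp (PiLp.proj 2 (fun _ : Site d L => Fib r) (e.1.shift e.2))).comp
      (ContinuousLinearMap.fst ℝ (SiteFun r d L) (OneForm r d L)))
  have hℓ₁v : ∀ p : SiteFun r d L × OneForm r d L, ℓ₁ p = lieIso r.ρ (p.1 e.1) := fun p => rfl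
  have hℓ₂v : ∀ p : SiteFun r d L × OneForm r d L, ℓ₂ p = lieIso r.ρ (p.2 e) := fun p => rfl
  have hℓ₃v : ∀ p : SiteFun r d L × OneForm r d L, ℓ₃ p = -lieIso r.ρ (p.1 (e.1.shift e.2)) := fun p => rfl
  have hE : HasStrictFDerivAt (exp : Matrix (Fin r.N) (Fin r.N) ℂ → Matrix (Fin r.N) (Fin r.N) ℂ)
      (1 : Matrix (Fin r.N) (Fin r.N) ℂ →L[ℝ] Matrix (Fin r.N) (Fin r.N) ℂ) 0 :=
    hasStrictFDerivAt_exp_zero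
  have hD : ∀ ℓ : (SiteFun r d L × OneForm r d L) →L[ℝ] Matrix (Fin r.N) (Fin r.N) ℂ,
      HasStrictFDerivAt (fun p => exp (ℓ p)) ℓ 0 := by
    intro ℓ
    have h := hE
    rw [← map_zero ℓ] at h
    exact (h.comp 0 ℓ.hasStrictFDerivAt).congr_fderiv (ContinuousLinearMap.ext fun _ => rfl)
  have h := (((hD ℓ₁).fun_mul' (hD ℓ₂)).mul_const' (r.ρ (τ e))).fun_mul' (hD ℓ₃)
  -- the same derivative, re-elaborated in the present instance context (needed for `simp` below)
  have h' : HasStrictFDerivAt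
      (fun p : SiteFun r d L × OneForm r d L => exp (ℓ₁ p) * exp (ℓ₂ p) * r.ρ (τ e) * exp (ℓ₃ p))
      ((exp (ℓ₁ 0) * exp (ℓ₂ 0) * r.ρ (τ e)) • ℓ₃ +
        MulOpposite.op (exp (ℓ₃ 0)) • MulOpposite.op (r.ρ (τ e)) •
          (exp (ℓ₁ 0) • ℓ₂ + MulOpposite.op (exp (ℓ₂ 0)) • ℓ₁)) 0 := h
  have hfun : (fun p : SiteFun r d L × OneForm r d L => r.ρ (gaugeTransform (gaugeExp r p.1) (cfg r τ p.2) e)) =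
      fun p => exp (ℓ₁ p) * exp (ℓ₂ p) * r.ρ (τ e) * exp (ℓ₃ p) := by
    funext p
    rw [rho_gaugeTransform_gaugeExp_cfg, hℓ₁v, hℓ₂v, hℓ₃v]
  refine ⟨_, by rw [hfun]; exact h', fun v => ?_⟩
  rw [lieIso_dZero_add_mul]
  simp only [_root_.add_apply, _root_.smul_apply, smul_eq_mul, op_smul_eq_mul, map_zero, exp_zero,
    Matrix.one_mul, Matrix.mul_one]
  rw [hℓ₁v, hℓ₂v, hℓ₃v, Matrix.mul_neg, Matrix.add_mul]
  abel

/-- **Strict derivative of the parametrisation at `0`**, assembled over the edges: a continuous linear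
`L` with `L(η̇, Ȧ) e = M((d⁰η̇) e + Ȧ e) · ρ(τ e)`. -/
theorem exists_hasStrictFDerivAt (τ : GaugeConfig d L G) :
    ∃ Lm : (SiteFun r d L × OneForm r d L) →L[ℝ] (Edge d L → Matrix (Fin r.N) (Fin r.N) ℂ),
      HasStrictFDerivAt (fun p : SiteFun r d L × OneForm r d L => fun e : Edge d L =>
        r.ρ (gaugeTransform (gaugeExp r p.1) (cfg r τ p.2) e)) Lm 0 ∧
      ∀ (v : SiteFun r d L × OneForm r d L) (e : Edge d L),
        Lm v e = lieIso r.ρ (dZero r τ v.1 e + v.2 e) * r.ρ (τ e) := by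
  choose φ' hφ' hφ'v using fun e : Edge d L => exists_hasStrictFDerivAt_comp r τ e
  exact ⟨ContinuousLinearMap.pi φ', hasStrictFDerivAt_pi.2 hφ', fun v e => hφ'v e v⟩

/-! ## Injectivity of the derivative on `W₀ᗮ × 𝒴` -/

/-- **Algebraic injectivity**: if `η ⊥ W₀`, `A ∈ 𝒴 = (range d⁰)ᗮ` and `d⁰η + A = 0`, then `η = 0` and
`A = 0` (`A ∈ range d⁰ ∩ (range d⁰)ᗮ`, then `d⁰η = 0` says `η ∈ W₀`). -/
theorem eq_zero_of_dZero_add_eq_zero (τ : GaugeConfig d L G) {η : SiteFun r d L} {A : OneForm r d L}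
    (hη : η ∈ (zeroModes r τ)ᗮ) (hA : A ∈ slice r τ) (h : ∀ e : Edge d L, dZero r τ η e + A e = 0) :
    η = 0 ∧ A = 0 := by
  have hAeq : dZero r τ (-η) = A := PiLp.ext fun e => by
    rw [map_neg, PiLp.neg_apply]
    exact (eq_neg_of_add_eq_zero_right (h e)).symm
  have hA0 : A = 0 := by
    rw [slice, Submodule.mem_orthogonal] at hA
    exact inner_self_eq_zero.1 (hA A ⟨-η, hAeq⟩)
  have hd : ∀ e : Edge d L, dZero r τ η e = 0 := fun e => by
    have := h e
    rwa [hA0, PiLp.zero_apply, add_zero] at this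
  have hz : η ∈ zeroModes r τ := by
    rw [mem_zeroModes_iff]
    intro i
    refine PiLp.ext fun x => ?_
    have := hd (x, i)
    rw [dZero_apply, sub_eq_zero] at this
    rw [transport_apply]
    exact this.symm
  rw [Submodule.mem_orthogonal] at hη
  exact ⟨inner_self_eq_zero.1 (hη η hz), hA0⟩

/-- **The derivative is bounded below on `W₀ᗮ × 𝒴`**: `m ‖(η, A)‖ ≤ ‖L(η, A)‖` for some `m > 0`
(injective by `eq_zero_of_dZero_add_eq_zero`, finite dimension). -/
theorem exists_lower_bound (τ : GaugeConfig d L G)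
    (Lm : (SiteFun r d L × OneForm r d L) →L[ℝ] (Edge d L → Matrix (Fin r.N) (Fin r.N) ℂ))
    (hLm : ∀ (v : SiteFun r d L × OneForm r d L) (e : Edge d L),
      Lm v e = lieIso r.ρ (dZero r τ v.1 e + v.2 e) * r.ρ (τ e)) :
    ∃ m : ℝ, 0 < m ∧ ∀ a ∈ (zeroModes r τ)ᗮ, ∀ b ∈ slice r τ, m * ‖(a, b)‖ ≤ ‖Lm (a, b)‖ := by
  set P : Submodule ℝ (SiteFun r d L × OneForm r d L) := ((zeroModes r τ)ᗮ).prod (slice r τ)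
  set Ψ : P →ₗ[ℝ] (Edge d L → Matrix (Fin r.N) (Fin r.N) ℂ) :=
    (Lm : (SiteFun r d L × OneForm r d L) →ₗ[ℝ] (Edge d L → Matrix (Fin r.N) (Fin r.N) ℂ)).comp P.subtype
  have hΨv : ∀ v : P, Ψ v = Lm (v : SiteFun r d L × OneForm r d L) := fun v => rfl
  have hker : LinearMap.ker Ψ = ⊥ := by
    rw [LinearMap.ker_eq_bot']
    intro v hv
    obtain ⟨hv1, hv2⟩ := Submodule.mem_prod.1 v.2
    have h0 : ∀ e : Edge d L, dZero r τ (v : SiteFun r d L × OneForm r d L).1 e +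
        (v : SiteFun r d L × OneForm r d L).2 e = 0 := fun e => by
      have he : Lm (v : SiteFun r d L × OneForm r d L) e = 0 := by rw [← hΨv, hv]; rfl
      rw [hLm] at he
      have he' : lieIso r.ρ (dZero r τ (v : SiteFun r d L × OneForm r d L).1 e +
          (v : SiteFun r d L × OneForm r d L).2 e) = 0 := by
        have := congrArg (· * r.ρ (τ e)⁻¹) he
        simpa only [Matrix.mul_assoc, rho_mul_inv, Matrix.mul_one, Matrix.zero_mul] using this
      rw [← norm_eq_zero, ← norm_lieIso r.ρ, he', norm_zero]
    obtain ⟨h1, h2⟩ := eq_zero_of_dZero_add_eq_zero r τ hv1 hv2 h0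
    exact Subtype.ext (Prod.ext h1 h2)
  obtain ⟨K, hK0, hK⟩ := Ψ.exists_antilipschitzWith hker
  have hKpos : (0 : ℝ) < K := by exact_mod_cast hK0
  refine ⟨(K : ℝ)⁻¹, by positivity, fun a ha b hb => ?_⟩
  have hle : ‖((a, b) : SiteFun r d L × OneForm r d L)‖ ≤ K * ‖Ψ ⟨(a, b), Submodule.mem_prod.2 ⟨ha, hb⟩⟩‖ := by
    have := hK.le_mul_dist ⟨(a, b), Submodule.mem_prod.2 ⟨ha, hb⟩⟩ 0
    rw [dist_zero_right, map_zero, dist_zero_right] at this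
    exact this
  rw [inv_mul_le_iff₀ hKpos]
  exact hle

end SliceLoc

/-- **Local injectivity of the slice parametrisation with a constant (`stub_sliceLoc`).**  For every
configuration `τ` there are `δ, K > 0` such that for `η, η' ⊥ zeroModes τ`, `A, A' ∈ slice τ`, all of
norm `< δ`, and `0 < s ≤ 1`, the matrix tuples `F(η, A) = (ρ((E η · cfg τ A) e))_e` satisfy
`s ‖F(η, A) − F(η', A')‖ ≤ K ‖F(η, sA) − F(η', sA')‖` (sup-of-Frobenius norm): the scaling
`A ↦ sA` of the slice coordinate is well defined on gauge orbits and co-Lipschitz by `K/s`. -/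
theorem sliceLoc {G : Type} [Group G] [TopologicalSpace G] [CompactSpace G] (r : LatticeRep G) {d L : ℕ} [NeZero L]
    (τ : GaugeConfig d L G) :
    ∃ δ K : ℝ, 0 < δ ∧ 0 < K ∧ ∀ (η η' : SiteFun r d L) (A A' : OneForm r d L),
      η ∈ (zeroModes r τ)ᗮ → η' ∈ (zeroModes r τ)ᗮ → A ∈ slice r τ → A' ∈ slice r τ →
      ‖η‖ < δ → ‖η'‖ < δ → ‖A‖ < δ → ‖A'‖ < δ → ∀ s : ℝ, 0 < s → s ≤ 1 →
        s * ‖(fun e : Edge d L => r.ρ (gaugeTransform (gaugeExp r η) (cfg r τ A) e) -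
            r.ρ (gaugeTransform (gaugeExp r η') (cfg r τ A') e))‖ ≤
          K * ‖(fun e : Edge d L => r.ρ (gaugeTransform (gaugeExp r η) (cfg r τ (s • A)) e) -
            r.ρ (gaugeTransform (gaugeExp r η') (cfg r τ (s • A')) e))‖ := by
  obtain ⟨Lm, hF, hLm⟩ := SliceLoc.exists_hasStrictFDerivAt r τ
  obtain ⟨m, hm, hle⟩ := SliceLoc.exists_lower_bound r τ Lm hLm
  obtain ⟨δ, K, hδ, hK, h⟩ :=
    Summit.QuantumFields.YangMills.Theorems.FemtoCurvatureTwoPointC.SliceLoc.coLipschitz_of_hasStrictFDerivAt hF ((zeroModes r τ)ᗮ) (slice r τ) hm hle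
  refine ⟨δ, K, hδ, hK, fun η η' A A' hη hη' hA hA' hηn hη'n hAn hA'n s hs hs1 => ?_⟩
  exact h η η' A A' (Submodule.sub_mem _ hη hη') (Submodule.sub_mem _ hA hA') hηn hη'n hAn hA'n s hs hs1

end Summit.QuantumFields.YangMills.Theorems.LocalInsertion.SublevelDoubling

end
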